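import Literature.Probability.RandomPlanarGeometry.BrownianExitPathLaw
import Mathlib.Probability.Independence.Integration
import HarnessLib

/-!
# Skorokhod embedding: the probabilistic calculus of one embedding step

Topic `Probability/RandomPlanarGeometry`, sub-namespace `SkorokhodEmbedding` (support file for
Lawler–Schramm–Werner (2004), Lemma 3.8 / Durrett (2019), Thms. 8.1.1, 8.2.1). Everything here is
PROVED; no named fact is introduced.

One step of the embedding (Durrett (2019), proof of Thm. 8.2.1) takes place on a probability
space `(Ω₁, Q)` carrying the **known data** `K : Ω₁ → 𝒦` (the past, including the fresh
randomiser) and a **fresh Brownian path** `Z : Ω₁ → C([0, ∞), ℝ)`, independent of `K` with the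
Wiener law; a measurable **level map** `ℓ : 𝒦 → ℝ × ℝ` with finitely many values selects the
interval `(ℓ₁, ℓ₂)` to be exited (a genuine pair `ℓ₁ < 0 < ℓ₂`, or the zero pair `(0, 0)`;
every statement below holds for arbitrary levels, a path started outside `(ℓ₁, ℓ₂)` exiting at
time `0`). The step produces the exit time `T`, the exit value `V`, the pre-exit path and
the **post-exit path** `Z'`. We prove:

* `indepFun_prodMk_of_indepFun_of_indepFun_pair` (L1): `Z ⊥ A` and `(Z, A) ⊥ U` give
  `Z ⊥ (A, U)` (product laws on `α × β × γ`, Mathlib `Measure.ext_prod₃`);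
* the **strong Markov property of the step** (`indepFun_stepPost`, `map_stepPost`): `Z'` is again
  a Brownian path, independent of `(K, T, pre-exit path)` — from the path-space strong Markov
  property at a fixed exit time (`BrownianExitPathLaw`) mixed over the finitely many levels;
* the **step integrals** (`integral_mul_comp_stepValue`, `integral_mul_stepTime_sub_sq`,
  `integral_mul_stepTime_sq_le`): against any bounded measurable weight `g(K)`,
  `E[g(K) f(V)] = E[g(K) · twoPointAvg ℓ(K) f]` (gambler's ruin), `E[g(K) (T - V²)] = 0`
  (`ET = -ab = EB_T²`), `E[g(K) T²] ≤ C₄ R⁴ E[g(K)]` for `g ≥ 0` when `ℓ₂ - ℓ₁ ≤ R`.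

## References

* R. Durrett, *Probability: Theory and Examples*, 5th ed. (2019), Thms. 8.1.1, 8.2.1.
* G. F. Lawler, O. Schramm, W. Werner, Ann. Probab. 32 (2004), Lemma 3.8.
* J.-F. Le Gall, *Brownian Motion, Martingales, and Stochastic Calculus* (2016), Thm. 2.20.
-/

noncomputable section

open MeasureTheory ProbabilityTheory Filter Set
open scoped NNReal ENNReal Topology

namespace Literature.Probability.RandomPlanarGeometry.SkorokhodEmbedding

open Literature.Probability.Process Literature.Probability.RandomPlanarGeometry

/-! ### L1: independence algebra -/

section IndepAlgebra

variable {Ω₁ α β γ : Type*} [MeasurableSpace Ω₁] [MeasurableSpace α] [MeasurableSpace β]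
  [MeasurableSpace γ] {Q : Measure Ω₁} {Z : Ω₁ → α} {A : Ω₁ → β} {U : Ω₁ → γ}

/-- **L1.** If `Z ⊥ A` and `(Z, A) ⊥ U` then `Z ⊥ (A, U)` (all three laws factor, by
`Measure.ext_prod₃`). [folklore] -/
theorem indepFun_prodMk_of_indepFun_of_indepFun_pair [IsProbabilityMeasure Q]
    (hZ : Measurable Z) (hA : Measurable A)
    (hU : Measurable U) (hZA : IndepFun Z A Q) (hZAU : IndepFun (fun ω ↦ (Z ω, A ω)) U Q) :
    IndepFun Z (fun ω ↦ (A ω, U ω)) Q := by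
  have hAU : IndepFun A U Q := by
    have := hZAU.comp (φ := Prod.snd) (ψ := id) measurable_snd measurable_id
    exact this
  rw [indepFun_iff_map_prod_eq_prod_map_map hZ.aemeasurable (hA.prodMk hU).aemeasurable]
  haveI : IsFiniteMeasure (Q.map fun ω ↦ (Z ω, A ω, U ω)) := Measure.isFiniteMeasure_map _ _
  refine Measure.ext_prod₃ fun {s t u} hs ht hu ↦ ?_
  rw [Measure.map_apply (hZ.prodMk (hA.prodMk hU)) (hs.prod (ht.prod hu)),
    Measure.prod_prod, Measure.map_apply hZ hs, Measure.map_apply (hA.prodMk hU) (ht.prod hu)]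
  have h1 : (fun ω ↦ (Z ω, A ω, U ω)) ⁻¹' (s ×ˢ t ×ˢ u) = Z ⁻¹' s ∩ (A ⁻¹' t ∩ U ⁻¹' u) := by
    ext ω; simp
  have h2 : (fun ω ↦ (A ω, U ω)) ⁻¹' (t ×ˢ u) = A ⁻¹' t ∩ U ⁻¹' u := by
    ext ω; simp
  rw [h1, h2]
  have hZA' := hZA.measure_inter_preimage_eq_mul s t hs ht
  have hAU' := hAU.measure_inter_preimage_eq_mul t u ht hu
  have hZAU' := hZAU.measure_inter_preimage_eq_mul (s ×ˢ t) u (hs.prod ht) hu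
  have h3 : (fun ω ↦ (Z ω, A ω)) ⁻¹' (s ×ˢ t) = Z ⁻¹' s ∩ A ⁻¹' t := by ext ω; simp
  rw [h3] at hZAU'
  rw [← inter_assoc, hZAU', hZA', hAU', mul_assoc]

/-- Independence is preserved when the second variable is post-composed with a swap of its
components. [folklore] -/
theorem indepFun_prodMk_swap {Y : Ω₁ → α} (h : IndepFun Y (fun ω ↦ (A ω, U ω)) Q) :
    IndepFun Y (fun ω ↦ (U ω, A ω)) Q :=
  h.comp (φ := id) (ψ := Prod.swap) measurable_id measurable_swap

end IndepAlgebra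

/-! ### Levels and the strong Markov property of the step at a fixed level -/

/-- A **genuine level pair** `ℓ₁ < 0 < ℓ₂` (as opposed to a pair whose interval does not contain
the starting point `0`, e.g. the zero pair `(0, 0)`, for which the exit time vanishes).
Durrett (2019), proof of Thm. 8.1.1 (`u < 0 < v`). [folklore] -/
def IsGenuine (l : ℝ × ℝ) : Prop := l.1 < 0 ∧ 0 < l.2

/-- The **two-point average** of `f` over the exit distribution of the level pair `l`:
`(ℓ₂ f(ℓ₁) - ℓ₁ f(ℓ₂))/(ℓ₂ - ℓ₁)` for a genuine pair (gambler's ruin), and `f 0` otherwise (the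
path exits at time `0` at its starting point). Durrett (2019), proof of Thm. 8.1.1 (`μ_{u,v}`,
`μ_{0,0} = δ_0`). [folklore] -/
def twoPointAvg (l : ℝ × ℝ) (f : ℝ → ℝ) : ℝ :=
  if l.1 < 0 ∧ 0 < l.2 then (l.2 * f l.1 - l.1 * f l.2) / (l.2 - l.1) else f 0

/-- The **exit pair** of a path at the level pair `l`: (exit time, pre-exit path) — the
`𝓕_T`-information of the strong Markov property. [folklore] -/
def exitPair (l : ℝ × ℝ) (p : C(ℝ≥0, ℝ)) : WithTop ℝ≥0 × C(ℝ≥0, ℝ) :=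
  (pathExitTime l.1 l.2 p, preExitPath l.1 l.2 p)

/-- The map completing the exit pair `(T, q)` to the **exit data** `(T, q, q(T), T)` (exit time,
pre-exit path, exit value, real exit time): the exit value is the value of the pre-exit path at
the exit time, with matching junk conventions. [folklore] -/
def dataMap (x : WithTop ℝ≥0 × C(ℝ≥0, ℝ)) : WithTop ℝ≥0 × C(ℝ≥0, ℝ) × ℝ × ℝ :=
  (x.1, x.2, x.2 x.1.untopA, ((x.1.untopD 0 : ℝ≥0) : ℝ))

/-- The **exit data** of a path at the level pair `l`: (exit time, pre-exit path, exit value,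
real exit time). [folklore] -/
def exitData (l : ℝ × ℝ) (p : C(ℝ≥0, ℝ)) : WithTop ℝ≥0 × C(ℝ≥0, ℝ) × ℝ × ℝ :=
  (pathExitTime l.1 l.2 p, preExitPath l.1 l.2 p, pathExitValue l.1 l.2 p, pathExitTimeReal l.1 l.2 p)

/-- Stopping a clock at its own value: `(min ↑(T.untopA) T).untopA = T.untopA`. [folklore] -/
theorem untopA_min_coe_untopA (T : WithTop ℝ≥0) :
    (min ((T.untopA : ℝ≥0) : WithTop ℝ≥0) T).untopA = T.untopA := by
  cases T with
  | top => rw [min_top_right]; rfl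
  | coe t => rw [show ((t : WithTop ℝ≥0)).untopA = t from rfl, min_self]; rfl

/-- **The exit value is the pre-exit path evaluated at the exit time** (including the junk
conventions when the path never exits). [folklore] -/
theorem pathExitValue_eq_preExitPath_apply (a b : ℝ) (p : C(ℝ≥0, ℝ)) :
    pathExitValue a b p = preExitPath a b p (pathExitTime a b p).untopA := by
  change p (pathExitTime a b p).untopA = p (min (((pathExitTime a b p).untopA : ℝ≥0) : WithTop ℝ≥0)
    (pathExitTime a b p)).untopA
  rw [untopA_min_coe_untopA]

/-- The exit data is the completion of the exit pair. [folklore] -/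
theorem exitData_eq_dataMap_exitPair (l : ℝ × ℝ) (p : C(ℝ≥0, ℝ)) :
    exitData l p = dataMap (exitPair l p) := by
  simp only [exitData, dataMap, exitPair, pathExitValue_eq_preExitPath_apply]
  rfl

/-- A path starting outside `(a, b)` has exit time `0`. [folklore] -/
theorem pathExitTime_eq_zero_of_notMem {a b : ℝ} {p : C(ℝ≥0, ℝ)} (h : p 0 ∉ Ioo a b) :
    pathExitTime a b p = 0 := by
  apply le_antisymm
  · exact hittingAfter_le_of_mem (u := coordProcess) (s := (Ioo a b)ᶜ) le_rfl h
  · exact le_hittingAfter (u := coordProcess) (s := (Ioo a b)ᶜ) (n := (0 : ℝ≥0)) p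

/-- For a non-genuine level pair and a path starting at `0`, the exit time is `0`. [folklore] -/
theorem pathExitTime_eq_zero_of_not_isGenuine {l : ℝ × ℝ} (hl : ¬ IsGenuine l) {p : C(ℝ≥0, ℝ)}
    (hp : p 0 = 0) : pathExitTime l.1 l.2 p = 0 :=
  pathExitTime_eq_zero_of_notMem (by rw [hp]; exact fun h ↦ hl ⟨h.1, h.2⟩)

/-- For a non-genuine level pair and a path starting at `0`: the post-exit path is the path
itself. [folklore] -/
theorem postExitPath_eq_of_not_isGenuine {l : ℝ × ℝ} (hl : ¬ IsGenuine l) {p : C(ℝ≥0, ℝ)}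
    (hp : p 0 = 0) : postExitPath l.1 l.2 p = p := by
  ext u
  rw [postExitPath_apply_of_eq_coe (pathExitTime_eq_zero_of_not_isGenuine hl hp), zero_add, hp,
    sub_zero]

/-- For a non-genuine level pair and a path starting at `0`: the exit pair is `(0, 0)`.
[folklore] -/
theorem exitPair_eq_of_not_isGenuine {l : ℝ × ℝ} (hl : ¬ IsGenuine l) {p : C(ℝ≥0, ℝ)}
    (hp : p 0 = 0) : exitPair l p = (((0 : ℝ≥0) : WithTop ℝ≥0), (0 : C(ℝ≥0, ℝ))) := by
  have hT := pathExitTime_eq_zero_of_not_isGenuine hl hp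
  change (pathExitTime l.1 l.2 p, preExitPath l.1 l.2 p) = _
  rw [hT]
  congr 1
  ext u
  have hmin : min u 0 = 0 := by simp
  rw [preExitPath_apply_of_eq_coe hT, hmin, hp]
  rfl

/-- For a non-genuine level pair and a path starting at `0`: the exit value is `0`. [folklore] -/
theorem pathExitValue_eq_of_not_isGenuine {l : ℝ × ℝ} (hl : ¬ IsGenuine l) {p : C(ℝ≥0, ℝ)}
    (hp : p 0 = 0) : pathExitValue l.1 l.2 p = 0 := by
  rw [pathExitValue_of_eq_coe (pathExitTime_eq_zero_of_not_isGenuine hl hp), hp]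

/-- For a non-genuine level pair and a path starting at `0`: the real exit time is `0`.
[folklore] -/
theorem pathExitTimeReal_eq_of_not_isGenuine {l : ℝ × ℝ} (hl : ¬ IsGenuine l) {p : C(ℝ≥0, ℝ)}
    (hp : p 0 = 0) : pathExitTimeReal l.1 l.2 p = 0 := by
  rw [pathExitTimeReal_of_eq_coe (pathExitTime_eq_zero_of_not_isGenuine hl hp)]
  rfl

section FixedLevel

variable [MeasurableSpace C(ℝ≥0, ℝ)] [BorelSpace C(ℝ≥0, ℝ)]

/-- The exit pair is a measurable functional of the path. [folklore] -/
theorem measurable_exitPair (l : ℝ × ℝ) : Measurable (exitPair l) :=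
  (measurable_pathExitTime _ _).prodMk (measurable_preExitPath _ _)

/-- The completion map is measurable (evaluation of a path at a measurable random time).
[folklore] -/
theorem measurable_dataMap : Measurable dataMap := by
  refine measurable_fst.prodMk (measurable_snd.prodMk (Measurable.prodMk ?_ ?_))
  · exact measurable_uncurry_coordProcess.comp
      ((measurable_fst.untopA).prodMk measurable_snd)
  · exact ((measurable_fst.untopD _).coe_nnreal_real)

/-- The exit data is a measurable functional of the path. [folklore] -/
theorem measurable_exitData (l : ℝ × ℝ) : Measurable (exitData l) :=
  (measurable_pathExitTime _ _).prodMk ((measurable_preExitPath _ _).prodMk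
    ((measurable_pathExitValue _ _).prodMk (measurable_pathExitTimeReal _ _)))

/-- **Strong Markov at a fixed level, law**: under the Wiener law the post-exit map preserves
the law — genuine pairs by `map_postExitPath_wienerLawC`, other pairs because the post-exit path
is a.s. the path itself. [cite: Legall2016, Thm. 2.20] -/
theorem map_postExitPath_level (l : ℝ × ℝ) : wienerLawC.map (postExitPath l.1 l.2) = wienerLawC := by
  by_cases hl : IsGenuine l
  · exact map_postExitPath_wienerLawC hl.1 hl.2
  · have hae : postExitPath l.1 l.2 =ᵐ[wienerLawC] id := by
      filter_upwards [ae_apply_zero_eq_zero_wienerLawC] with p hp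
      rw [postExitPath_eq_of_not_isGenuine hl hp, id]
    rw [Measure.map_congr hae, Measure.map_id]

/-- **Strong Markov at a fixed level, independence**: under the Wiener law the post-exit path is
independent of the exit pair — genuine pairs by `indepFun_postExitPath_wienerLawC`, other pairs
because their exit pair is a.s. constant. [cite: Legall2016, Thm. 2.20] -/
theorem indepFun_postExitPath_exitPair_level (l : ℝ × ℝ) :
    IndepFun (postExitPath l.1 l.2) (exitPair l) wienerLawC := by
  by_cases hl : IsGenuine l
  · exact indepFun_postExitPath_wienerLawC hl.1 hl.2
  · have hconst : exitPair l =ᵐ[wienerLawC] fun _ ↦ (((0 : ℝ≥0) : WithTop ℝ≥0), (0 : C(ℝ≥0, ℝ))) := by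
      filter_upwards [ae_apply_zero_eq_zero_wienerLawC] with p hp
      exact exitPair_eq_of_not_isGenuine hl hp
    exact (indepFun_const_right (postExitPath l.1 l.2) _).congr EventuallyEq.rfl hconst.symm

/-- **Strong Markov at a fixed level, independence from the exit data** (the exit data is a
measurable function of the exit pair). [cite: Legall2016, Thm. 2.20] -/
theorem indepFun_postExitPath_exitData_level (l : ℝ × ℝ) :
    IndepFun (postExitPath l.1 l.2) (exitData l) wienerLawC := by
  have h := (indepFun_postExitPath_exitPair_level l).comp (φ := id) (ψ := dataMap) measurable_id
    measurable_dataMap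
  have heq : dataMap ∘ exitPair l = exitData l := by
    funext p
    exact (exitData_eq_dataMap_exitPair l p).symm
  rwa [heq] at h

variable {Ω₁ 𝒦 : Type*} [MeasurableSpace Ω₁] [MeasurableSpace 𝒦] {Q : Measure Ω₁}
  {K : Ω₁ → 𝒦} {Z : Ω₁ → C(ℝ≥0, ℝ)}

/-- **L2, law.** If `Z` has the Wiener law then so does its post-exit path at any level.
[cite: Legall2016, Thm. 2.20] -/
theorem map_postExitPath_comp (hZ : Measurable Z) (hlaw : Q.map Z = wienerLawC) (l : ℝ × ℝ) :
    Q.map (fun ω ↦ postExitPath l.1 l.2 (Z ω)) = wienerLawC := by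
  change Q.map (postExitPath l.1 l.2 ∘ Z) = wienerLawC
  rw [← Measure.map_map (measurable_postExitPath _ _) hZ, hlaw]
  exact map_postExitPath_level l

/-- **L2, independence.** If `Z ⊥ K` and `Z` has the Wiener law, then at any level the post-exit
path of `Z` is independent of `(K, exit data of Z)`. Durrett (2019), proof of Thm. 8.2.1.
[cite: Legall2016, Thm. 2.20] -/
theorem indepFun_postExitPath_comp [IsProbabilityMeasure Q] (hK : Measurable K) (hZ : Measurable Z)
    (hZK : IndepFun Z K Q) (hlaw : Q.map Z = wienerLawC) (l : ℝ × ℝ) :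
    IndepFun (fun ω ↦ postExitPath l.1 l.2 (Z ω)) (fun ω ↦ (K ω, exitData l (Z ω))) Q := by
  -- `post ∘ Z ⊥ data ∘ Z`: transported from the Wiener law along `Z`
  have hpd : IndepFun (fun ω ↦ postExitPath l.1 l.2 (Z ω)) (fun ω ↦ exitData l (Z ω)) Q := by
    have h := indepFun_postExitPath_exitData_level l
    rw [indepFun_iff_map_prod_eq_prod_map_map (measurable_postExitPath _ _).aemeasurable
      (measurable_exitData l).aemeasurable, ← hlaw,
      Measure.map_map ((measurable_postExitPath _ _).prodMk (measurable_exitData l)) hZ,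
      Measure.map_map (measurable_postExitPath _ _) hZ, Measure.map_map (measurable_exitData l) hZ] at h
    exact (indepFun_iff_map_prod_eq_prod_map_map
      ((measurable_postExitPath _ _).comp hZ).aemeasurable
      ((measurable_exitData l).comp hZ).aemeasurable).2 h
  -- `(post ∘ Z, data ∘ Z) ⊥ K`: a function of `Z`
  have hpair : IndepFun (fun ω ↦ (postExitPath l.1 l.2 (Z ω), exitData l (Z ω))) K Q :=
    hZK.comp (φ := fun p ↦ (postExitPath l.1 l.2 p, exitData l p)) (ψ := id)
      ((measurable_postExitPath _ _).prodMk (measurable_exitData l)) measurable_id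
  -- L1 and a swap
  exact indepFun_prodMk_swap (indepFun_prodMk_of_indepFun_of_indepFun_pair
    ((measurable_postExitPath _ _).comp hZ) ((measurable_exitData l).comp hZ) hK hpd hpair)

end FixedLevel

/-! ### Finitely many levels: measurability and decompositions -/

section Levels

variable {Ω₁ ι : Type*} [MeasurableSpace Ω₁] {lev : Ω₁ → ι}

/-- A map defined levelwise from finitely many measurable maps, along a level function with
finite range and measurable fibres, is measurable. [folklore] -/
theorem measurable_levelwise {β : Type*} [MeasurableSpace β] (hfin : (Set.range lev).Finite)
    (hlev : ∀ l, MeasurableSet (lev ⁻¹' {l})) {f : ι → Ω₁ → β} (hf : ∀ l, Measurable (f l)) :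
    Measurable fun ω ↦ f (lev ω) ω := by
  intro s hs
  have : (fun ω ↦ f (lev ω) ω) ⁻¹' s = ⋃ l ∈ hfin.toFinset, lev ⁻¹' {l} ∩ f l ⁻¹' s := by
    ext ω
    simp only [mem_preimage, mem_iUnion, mem_inter_iff, mem_singleton_iff, Finite.mem_toFinset,
      mem_range, exists_prop]
    constructor
    · intro h; exact ⟨lev ω, ⟨ω, rfl⟩, rfl, h⟩
    · rintro ⟨l, -, rfl, h⟩; exact h
  rw [this]
  exact MeasurableSet.biUnion (Finset.countable_toSet _) fun l _ ↦ (hlev l).inter (hf l hs)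

variable {Q : Measure Ω₁}

/-- **Decomposition of an integral along finitely many levels**:
`∫ F = ∑_l ∫ 𝟙{lev = l} F`. [folklore] -/
theorem integral_eq_sum_levels (hfin : (Set.range lev).Finite) (hlev : ∀ l, MeasurableSet (lev ⁻¹' {l}))
    {F : Ω₁ → ℝ} (hF : Integrable F Q) :
    ∫ ω, F ω ∂Q = ∑ l ∈ hfin.toFinset, ∫ ω, (lev ⁻¹' {l}).indicator F ω ∂Q := by
  classical
  have hpt : ∀ ω, F ω = ∑ l ∈ hfin.toFinset, (lev ⁻¹' {l}).indicator F ω := by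
    intro ω
    rw [Finset.sum_eq_single (lev ω)]
    · rw [indicator_of_mem (by simp)]
    · intro l _ hl
      rw [indicator_of_notMem]
      simpa [mem_preimage, mem_singleton_iff] using fun h ↦ hl h.symm
    · intro h
      exact absurd (by simp : lev ω ∈ hfin.toFinset) h
  rw [integral_congr_ae (ae_of_all _ hpt), integral_finsetSum]
  exact fun l _ ↦ hF.indicator (hlev l)

/-- **Decomposition of a measure along finitely many levels**:
`Q(S) = ∑_l Q({lev = l} ∩ S)`. [folklore] -/
theorem measure_eq_sum_levels (hfin : (Set.range lev).Finite) (hlev : ∀ l, MeasurableSet (lev ⁻¹' {l}))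
    {S : Set Ω₁} (hS : MeasurableSet S) :
    Q S = ∑ l ∈ hfin.toFinset, Q (lev ⁻¹' {l} ∩ S) := by
  classical
  have hS' : S = ⋃ l ∈ hfin.toFinset, lev ⁻¹' {l} ∩ S := by
    ext ω
    simp only [mem_iUnion, mem_inter_iff, mem_preimage, mem_singleton_iff, Finite.mem_toFinset,
      mem_range, exists_prop]
    exact ⟨fun h ↦ ⟨lev ω, ⟨ω, rfl⟩, rfl, h⟩, fun ⟨_, _, _, h⟩ ↦ h⟩
  conv_lhs => rw [hS']
  rw [measure_biUnion_finset]
  · intro l _ l' _ hll'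
    exact Disjoint.mono inter_subset_left inter_subset_left
      (Disjoint.preimage _ (disjoint_singleton.2 hll'))
  · exact fun l _ ↦ (hlev l).inter hS

end Levels

/-! ### The level map of the step -/

section LevelMap

variable {Ω₁ 𝒦 : Type*} {K : Ω₁ → 𝒦} {ℓ : 𝒦 → ℝ × ℝ}

/-- The level fibres `{ℓ(K) = l}` are measurable. [folklore] -/
theorem measurableSet_level_fibre [MeasurableSpace Ω₁] [MeasurableSpace 𝒦] (hK : Measurable K)
    (hℓ : Measurable ℓ) (l : ℝ × ℝ) : MeasurableSet ((fun ω ↦ ℓ (K ω)) ⁻¹' {l}) :=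
  (hℓ.comp hK) (measurableSet_singleton l)

/-- The range of the random level is finite when `ℓ` has finite range. [folklore] -/
theorem finite_range_level (hfin : (Set.range ℓ).Finite) : (Set.range fun ω ↦ ℓ (K ω)).Finite :=
  hfin.subset (by rintro _ ⟨ω, rfl⟩; exact ⟨K ω, rfl⟩)

end LevelMap

/-! ### The step with a random level -/

section Step

variable [MeasurableSpace C(ℝ≥0, ℝ)] [BorelSpace C(ℝ≥0, ℝ)]
  {Ω₁ 𝒦 : Type*} [MeasurableSpace Ω₁] [MeasurableSpace 𝒦] {Q : Measure Ω₁}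
  [IsProbabilityMeasure Q] {K : Ω₁ → 𝒦} {Z : Ω₁ → C(ℝ≥0, ℝ)} {ℓ : 𝒦 → ℝ × ℝ}

/-- The **post-exit path of the step** at the random level `ℓ(K)`. [folklore] -/
def stepPost (K : Ω₁ → 𝒦) (Z : Ω₁ → C(ℝ≥0, ℝ)) (ℓ : 𝒦 → ℝ × ℝ) (ω : Ω₁) : C(ℝ≥0, ℝ) :=
  postExitPath (ℓ (K ω)).1 (ℓ (K ω)).2 (Z ω)

/-- The **exit data of the step** (exit time, pre-exit path) at the random level. [folklore] -/
def stepData (K : Ω₁ → 𝒦) (Z : Ω₁ → C(ℝ≥0, ℝ)) (ℓ : 𝒦 → ℝ × ℝ) (ω : Ω₁) :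
    WithTop ℝ≥0 × C(ℝ≥0, ℝ) × ℝ × ℝ :=
  exitData (ℓ (K ω)) (Z ω)

/-- The **exit value of the step** at the random level. [folklore] -/
def stepValue (K : Ω₁ → 𝒦) (Z : Ω₁ → C(ℝ≥0, ℝ)) (ℓ : 𝒦 → ℝ × ℝ) (ω : Ω₁) : ℝ :=
  pathExitValue (ℓ (K ω)).1 (ℓ (K ω)).2 (Z ω)

/-- The **real exit time of the step** at the random level. [folklore] -/
def stepTime (K : Ω₁ → 𝒦) (Z : Ω₁ → C(ℝ≥0, ℝ)) (ℓ : 𝒦 → ℝ × ℝ) (ω : Ω₁) : ℝ :=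
  pathExitTimeReal (ℓ (K ω)).1 (ℓ (K ω)).2 (Z ω)

/-- The post-exit path of the step is measurable. [folklore] -/
theorem measurable_stepPost (hK : Measurable K) (hZ : Measurable Z) (hℓ : Measurable ℓ)
    (hfin : (Set.range ℓ).Finite) : Measurable (stepPost K Z ℓ) :=
  measurable_levelwise (lev := fun ω ↦ ℓ (K ω)) (finite_range_level hfin)
    (measurableSet_level_fibre hK hℓ) (f := fun l ω ↦ postExitPath l.1 l.2 (Z ω))
    fun _ ↦ (measurable_postExitPath _ _).comp hZ

/-- The exit data of the step is measurable. [folklore] -/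
theorem measurable_stepData (hK : Measurable K) (hZ : Measurable Z) (hℓ : Measurable ℓ)
    (hfin : (Set.range ℓ).Finite) : Measurable (stepData K Z ℓ) :=
  measurable_levelwise (lev := fun ω ↦ ℓ (K ω)) (finite_range_level hfin)
    (measurableSet_level_fibre hK hℓ) (f := fun l ω ↦ exitData l (Z ω))
    fun l ↦ (measurable_exitData l).comp hZ

/-- The exit value of the step is measurable. [folklore] -/
theorem measurable_stepValue (hK : Measurable K) (hZ : Measurable Z) (hℓ : Measurable ℓ)
    (hfin : (Set.range ℓ).Finite) : Measurable (stepValue K Z ℓ) :=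
  measurable_levelwise (lev := fun ω ↦ ℓ (K ω)) (finite_range_level hfin)
    (measurableSet_level_fibre hK hℓ) (f := fun l ω ↦ pathExitValue l.1 l.2 (Z ω))
    fun _ ↦ (measurable_pathExitValue _ _).comp hZ

/-- The real exit time of the step is measurable. [folklore] -/
theorem measurable_stepTime (hK : Measurable K) (hZ : Measurable Z) (hℓ : Measurable ℓ)
    (hfin : (Set.range ℓ).Finite) : Measurable (stepTime K Z ℓ) :=
  measurable_levelwise (lev := fun ω ↦ ℓ (K ω)) (finite_range_level hfin)
    (measurableSet_level_fibre hK hℓ) (f := fun l ω ↦ pathExitTimeReal l.1 l.2 (Z ω))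
    fun _ ↦ (measurable_pathExitTimeReal _ _).comp hZ

omit [MeasurableSpace C(ℝ≥0, ℝ)] [BorelSpace C(ℝ≥0, ℝ)] [MeasurableSpace Ω₁] [MeasurableSpace 𝒦] in
/-- On the level fibre `{ℓ(K) = l}`, an event of the step is the corresponding fixed-level event
cut down by the fibre (which is itself an event of the known data). [folklore] -/
theorem level_inter_stepPost_inter (l : ℝ × ℝ) (S : Set C(ℝ≥0, ℝ))
    (W : Set (𝒦 × (WithTop ℝ≥0 × C(ℝ≥0, ℝ) × ℝ × ℝ))) :
    (fun ω ↦ ℓ (K ω)) ⁻¹' {l} ∩ (stepPost K Z ℓ ⁻¹' S ∩ (fun ω ↦ (K ω, stepData K Z ℓ ω)) ⁻¹' W) =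
      (fun ω ↦ postExitPath l.1 l.2 (Z ω)) ⁻¹' S ∩
        (fun ω ↦ (K ω, exitData l (Z ω))) ⁻¹' (W ∩ (ℓ ⁻¹' {l}) ×ˢ univ) := by
  ext ω
  simp only [mem_inter_iff, mem_preimage, mem_singleton_iff, mem_prod, mem_univ, and_true,
    stepPost, stepData]
  constructor
  · rintro ⟨h1, h2, h3⟩
    rw [show ℓ (K ω) = l from h1] at h2 h3
    exact ⟨h2, h3, h1⟩
  · rintro ⟨h2, h3, h1⟩
    rw [show ℓ (K ω) = l from h1]
    exact ⟨rfl, h2, h3⟩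

omit [MeasurableSpace C(ℝ≥0, ℝ)] [BorelSpace C(ℝ≥0, ℝ)] [MeasurableSpace Ω₁] [MeasurableSpace 𝒦] in
/-- On the level fibre, an event of the known data and the step data is a fixed-level event.
[folklore] -/
theorem level_inter_stepData (l : ℝ × ℝ) (W : Set (𝒦 × (WithTop ℝ≥0 × C(ℝ≥0, ℝ) × ℝ × ℝ))) :
    (fun ω ↦ ℓ (K ω)) ⁻¹' {l} ∩ (fun ω ↦ (K ω, stepData K Z ℓ ω)) ⁻¹' W =
      (fun ω ↦ (K ω, exitData l (Z ω))) ⁻¹' (W ∩ (ℓ ⁻¹' {l}) ×ˢ univ) := by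
  have h := level_inter_stepPost_inter (K := K) (Z := Z) (ℓ := ℓ) l univ W
  simpa only [preimage_univ, univ_inter] using h

/-- **Strong Markov property of the step, on level fibres**: for every level `l`, Borel `S` and
event `W` of (known data, step data),
`Q[ℓ(K) = l, Z' ∈ S, (K, data) ∈ W] = μW(S) · Q[ℓ(K) = l, (K, data) ∈ W]`. [folklore] -/
theorem measure_level_inter_stepPost (hK : Measurable K) (hZ : Measurable Z) (hℓ : Measurable ℓ)
    (hZK : IndepFun Z K Q) (hlaw : Q.map Z = wienerLawC) (l : ℝ × ℝ) {S : Set C(ℝ≥0, ℝ)}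
    (hS : MeasurableSet S) {W : Set (𝒦 × (WithTop ℝ≥0 × C(ℝ≥0, ℝ) × ℝ × ℝ))} (hW : MeasurableSet W) :
    Q ((fun ω ↦ ℓ (K ω)) ⁻¹' {l} ∩ (stepPost K Z ℓ ⁻¹' S ∩ (fun ω ↦ (K ω, stepData K Z ℓ ω)) ⁻¹' W)) =
      wienerLawC S * Q ((fun ω ↦ ℓ (K ω)) ⁻¹' {l} ∩ (fun ω ↦ (K ω, stepData K Z ℓ ω)) ⁻¹' W) := by
  have hind := indepFun_postExitPath_comp hK hZ hZK hlaw l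
  have hW' : MeasurableSet (W ∩ (ℓ ⁻¹' {l}) ×ˢ (univ : Set (WithTop ℝ≥0 × C(ℝ≥0, ℝ) × ℝ × ℝ))) :=
    hW.inter ((hℓ (measurableSet_singleton l)).prod MeasurableSet.univ)
  have hmapS : Q ((fun ω ↦ postExitPath l.1 l.2 (Z ω)) ⁻¹' S) = wienerLawC S := by
    rw [← Measure.map_apply (f := fun ω ↦ postExitPath l.1 l.2 (Z ω))
      ((measurable_postExitPath _ _).comp hZ) hS, map_postExitPath_comp hZ hlaw l]
  rw [level_inter_stepPost_inter, level_inter_stepData, hind.measure_inter_preimage_eq_mul _ _ hS hW',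
    hmapS]

/-- **Strong Markov property of the step, law**: the post-exit path of the step has the Wiener
law. Durrett (2019), proof of Thm. 8.2.1. [cite: Durrett2019, Thm. 8.2.1] -/
theorem map_stepPost (hK : Measurable K) (hZ : Measurable Z) (hℓ : Measurable ℓ)
    (hfin : (Set.range ℓ).Finite) (hZK : IndepFun Z K Q) (hlaw : Q.map Z = wienerLawC) :
    Q.map (stepPost K Z ℓ) = wienerLawC := by
  have hfin' := finite_range_level (K := K) hfin
  have hfib := measurableSet_level_fibre hK hℓ
  have hmP := measurable_stepPost hK hZ hℓ hfin
  have hmD := hK.prodMk (measurable_stepData hK hZ hℓ hfin)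
  ext S hS
  rw [Measure.map_apply hmP hS, measure_eq_sum_levels (Q := Q) hfin' hfib (hmP hS)]
  have hterm : ∀ l ∈ hfin'.toFinset, Q ((fun ω ↦ ℓ (K ω)) ⁻¹' {l} ∩ stepPost K Z ℓ ⁻¹' S) =
      wienerLawC S * Q ((fun ω ↦ ℓ (K ω)) ⁻¹' {l}) := by
    intro l _
    have h := measure_level_inter_stepPost hK hZ hℓ hZK hlaw l hS MeasurableSet.univ
    simpa only [preimage_univ, inter_univ] using h
  rw [Finset.sum_congr rfl hterm, ← Finset.mul_sum]
  have htot : ∑ l ∈ hfin'.toFinset, Q ((fun ω ↦ ℓ (K ω)) ⁻¹' {l}) = 1 := by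
    have := measure_eq_sum_levels (Q := Q) hfin' hfib MeasurableSet.univ
    simp only [inter_univ, measure_univ] at this
    exact this.symm
  rw [htot, mul_one]

/-- **Strong Markov property of the step, independence.** If `Z ⊥ K`, `Z` has the Wiener law,
and the random level `ℓ(K)` takes finitely many values, then the post-exit path of the step is
independent of `(K, exit data)`. Durrett (2019), proof of Thm. 8.2.1 (with the randomised
two-point embedding of Thm. 8.1.1 at each step). [cite: Durrett2019, Thm. 8.2.1] -/
theorem indepFun_stepPost (hK : Measurable K) (hZ : Measurable Z) (hℓ : Measurable ℓ)
    (hfin : (Set.range ℓ).Finite) (hZK : IndepFun Z K Q) (hlaw : Q.map Z = wienerLawC) :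
    IndepFun (stepPost K Z ℓ) (fun ω ↦ (K ω, stepData K Z ℓ ω)) Q := by
  have hfin' := finite_range_level (K := K) hfin
  have hfib := measurableSet_level_fibre hK hℓ
  have hmP := measurable_stepPost hK hZ hℓ hfin
  have hmD := hK.prodMk (measurable_stepData hK hZ hℓ hfin)
  rw [indepFun_iff_measure_inter_preimage_eq_mul]
  intro S W hS hW
  rw [measure_eq_sum_levels (Q := Q) hfin' hfib ((hmP hS).inter (hmD hW)),
    measure_eq_sum_levels (Q := Q) hfin' hfib (hmD hW), Finset.mul_sum,
    ← Measure.map_apply hmP hS, map_stepPost hK hZ hℓ hfin hZK hlaw]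
  exact Finset.sum_congr rfl fun l _ ↦ measure_level_inter_stepPost hK hZ hℓ hZK hlaw l hS hW

/-! ### The step integrals -/

omit [BorelSpace C(ℝ≥0, ℝ)] [IsProbabilityMeasure Q] in
/-- **Step integrals against a weight of the known data**: for a bounded measurable weight `g`
and a path functional `Ψ_l` depending on the level, with `Ψ_l` Wiener integrable for each level,
`E[g(K) Ψ_{ℓ(K)}(Z)] = ∑_l E[g(K) 𝟙{ℓ(K) = l}] · E_W[Ψ_l]` (independence of `Z` and `K` on each
level fibre). [folklore] -/
theorem integral_mul_levelwise (hK : Measurable K) (hZ : Measurable Z) (hℓ : Measurable ℓ)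
    (hfin : (Set.range ℓ).Finite) (hZK : IndepFun Z K Q) (hlaw : Q.map Z = wienerLawC)
    {g : 𝒦 → ℝ} (hg : Measurable g) {C : ℝ} (hgb : ∀ k, |g k| ≤ C)
    {Ψ : ℝ × ℝ → C(ℝ≥0, ℝ) → ℝ} (hΨm : ∀ l, Measurable (Ψ l))
    (hΨi : ∀ l, Integrable (Ψ l) wienerLawC) :
    ∫ ω, g (K ω) * Ψ (ℓ (K ω)) (Z ω) ∂Q =
      ∑ l ∈ (finite_range_level (K := K) hfin).toFinset,
        (∫ ω, (((fun ω ↦ ℓ (K ω)) ⁻¹' {l}).indicator (fun ω ↦ g (K ω)) ω) ∂Q) * ∫ p, Ψ l p ∂wienerLawC := by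
  set lev : Ω₁ → ℝ × ℝ := fun ω ↦ ℓ (K ω) with hlev
  have hfin' : (Set.range lev).Finite := finite_range_level hfin
  have hfib : ∀ l, MeasurableSet (lev ⁻¹' {l}) := measurableSet_level_fibre hK hℓ
  -- integrability of the integrand
  have hΨZ : ∀ l, Integrable (fun ω ↦ Ψ l (Z ω)) Q := fun l ↦ by
    have := (integrable_map_measure (hΨm l).aestronglyMeasurable hZ.aemeasurable).1 (hlaw ▸ hΨi l)
    exact this
  have hF : Integrable (fun ω ↦ g (K ω) * Ψ (lev ω) (Z ω)) Q := by
    have hm : Measurable fun ω ↦ Ψ (lev ω) (Z ω) :=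
      measurable_levelwise (lev := lev) hfin' hfib (f := fun l ω ↦ Ψ l (Z ω)) fun l ↦ (hΨm l).comp hZ
    -- dominate `|Ψ_{lev}(Z)|` by the finite sum of the `|Ψ_l(Z)|`
    have hdom : Integrable (fun ω ↦ ∑ l ∈ hfin'.toFinset, |Ψ l (Z ω)|) Q :=
      integrable_finsetSum _ fun l _ ↦ (hΨZ l).abs
    have hint : Integrable (fun ω ↦ Ψ (lev ω) (Z ω)) Q := by
      refine hdom.mono' hm.aestronglyMeasurable (ae_of_all _ fun ω ↦ ?_)
      rw [Real.norm_eq_abs]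
      exact Finset.single_le_sum (f := fun l ↦ |Ψ l (Z ω)|) (fun l _ ↦ abs_nonneg _)
        (by simp [hlev] : lev ω ∈ hfin'.toFinset)
    exact hint.bdd_mul (c := C) (hg.comp hK).aestronglyMeasurable
      (ae_of_all _ fun ω ↦ by rw [Real.norm_eq_abs]; exact hgb _)
  rw [integral_eq_sum_levels hfin' hfib hF]
  refine Finset.sum_congr rfl fun l _ ↦ ?_
  -- on the fibre `{lev = l}`: `𝟙 g(K) Ψ_l(Z)`, then independence of `K` and `Z`
  have hind : ∀ ω, (lev ⁻¹' {l}).indicator (fun ω ↦ g (K ω) * Ψ (lev ω) (Z ω)) ω =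
      (ℓ ⁻¹' {l}).indicator g (K ω) * Ψ l (Z ω) := by
    intro ω
    by_cases hω : ω ∈ lev ⁻¹' {l}
    · have hω' : K ω ∈ ℓ ⁻¹' {l} := hω
      rw [indicator_of_mem hω, indicator_of_mem hω', show lev ω = l from hω]
    · have hω' : K ω ∉ ℓ ⁻¹' {l} := hω
      rw [indicator_of_notMem hω, indicator_of_notMem hω', zero_mul]
  have hind' : ∀ ω, (lev ⁻¹' {l}).indicator (fun ω ↦ g (K ω)) ω = (ℓ ⁻¹' {l}).indicator g (K ω) := by
    intro ω
    by_cases hω : ω ∈ lev ⁻¹' {l}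
    · have hω' : K ω ∈ ℓ ⁻¹' {l} := hω
      rw [indicator_of_mem hω', indicator_of_mem hω]
    · have hω' : K ω ∉ ℓ ⁻¹' {l} := hω
      rw [indicator_of_notMem hω', indicator_of_notMem hω]
  simp_rw [hind]
  rw [integral_congr_ae (ae_of_all _ hind')]
  rw [IndepFun.integral_fun_comp_mul_comp (f := (ℓ ⁻¹' {l}).indicator g) (g := Ψ l) hZK.symm
    hK.aemeasurable hZ.aemeasurable ((hg.indicator (hℓ (measurableSet_singleton l))).aestronglyMeasurable)
    (hΨm l).aestronglyMeasurable, ← hlaw, integral_map hZ.aemeasurable (hΨm l).aestronglyMeasurable]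

omit [MeasurableSpace C(ℝ≥0, ℝ)] [BorelSpace C(ℝ≥0, ℝ)] in
/-- Recombination of level sums: `∑_l E[g(K)𝟙{ℓ(K)=l}] h(l) = E[g(K) h(ℓ(K))]`. [folklore] -/
theorem sum_integral_indicator_mul (hK : Measurable K) (hℓ : Measurable ℓ)
    (hfin : (Set.range ℓ).Finite) {g : 𝒦 → ℝ} (hg : Measurable g) {C : ℝ} (hgb : ∀ k, |g k| ≤ C)
    (h : ℝ × ℝ → ℝ) :
    ∑ l ∈ (finite_range_level (K := K) hfin).toFinset,
        (∫ ω, (((fun ω ↦ ℓ (K ω)) ⁻¹' {l}).indicator (fun ω ↦ g (K ω)) ω) ∂Q) * h l =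
      ∫ ω, g (K ω) * h (ℓ (K ω)) ∂Q := by
  set lev : Ω₁ → ℝ × ℝ := fun ω ↦ ℓ (K ω) with hlev
  have hfin' : (Set.range lev).Finite := finite_range_level hfin
  have hfib : ∀ l, MeasurableSet (lev ⁻¹' {l}) := measurableSet_level_fibre hK hℓ
  have hF : Integrable (fun ω ↦ g (K ω) * h (lev ω)) Q := by
    have hm : Measurable fun ω ↦ h (lev ω) :=
      measurable_levelwise (lev := lev) hfin' hfib (f := fun l _ ↦ h l) fun l ↦ measurable_const
    have hbd : ∀ ω, |h (lev ω)| ≤ ∑ l ∈ hfin'.toFinset, |h l| := fun ω ↦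
      Finset.single_le_sum (f := fun l ↦ |h l|) (fun l _ ↦ abs_nonneg _)
        (by simp [hlev] : lev ω ∈ hfin'.toFinset)
    have hint : Integrable (fun ω ↦ h (lev ω)) Q :=
      (integrable_const _).mono' hm.aestronglyMeasurable (ae_of_all _ fun ω ↦ by
        rw [Real.norm_eq_abs]; exact hbd ω)
    exact hint.bdd_mul (c := C) (hg.comp hK).aestronglyMeasurable
      (ae_of_all _ fun ω ↦ by rw [Real.norm_eq_abs]; exact hgb _)
  rw [integral_eq_sum_levels hfin' hfib hF]
  refine Finset.sum_congr rfl fun l _ ↦ ?_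
  rw [← integral_mul_const]
  refine integral_congr_ae (ae_of_all _ fun ω ↦ ?_)
  change (lev ⁻¹' {l}).indicator (fun ω ↦ g (K ω)) ω * h l =
    (lev ⁻¹' {l}).indicator (fun ω ↦ g (K ω) * h (lev ω)) ω
  by_cases hω : ω ∈ lev ⁻¹' {l}
  · rw [indicator_of_mem hω, indicator_of_mem hω, show lev ω = l from hω]
  · rw [indicator_of_notMem hω, indicator_of_notMem hω, zero_mul]

/-- **The two-point average is the Wiener integral of `f(exit value)`** at every level
(gambler's ruin for genuine pairs; exit at time `0` at the origin otherwise).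
[cite: Durrett2019, Thm. 8.1.1] -/
theorem integral_comp_pathExitValue_level (l : ℝ × ℝ) (f : ℝ → ℝ) :
    ∫ p, f (pathExitValue l.1 l.2 p) ∂wienerLawC = twoPointAvg l f := by
  by_cases hl : IsGenuine l
  · rw [integral_comp_pathExitValue_wienerLawC hl.1 hl.2, twoPointAvg,
      if_pos (show l.1 < 0 ∧ 0 < l.2 from hl)]
  · rw [twoPointAvg, if_neg (show ¬ (l.1 < 0 ∧ 0 < l.2) from hl)]
    have hae : (fun p ↦ f (pathExitValue l.1 l.2 p)) =ᵐ[wienerLawC] fun _ ↦ f 0 := by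
      filter_upwards [ae_apply_zero_eq_zero_wienerLawC] with p hp
      rw [pathExitValue_eq_of_not_isGenuine hl hp]
    rw [integral_congr_ae hae, integral_const, smul_eq_mul, probReal_univ, one_mul]

/-- At every level, `E_W[T - V²] = 0`. [cite: Durrett2019, Thm. 8.1.1] -/
theorem integral_pathExitTimeReal_sub_sq_level (l : ℝ × ℝ) :
    ∫ p, (pathExitTimeReal l.1 l.2 p - pathExitValue l.1 l.2 p ^ 2) ∂wienerLawC = 0 := by
  by_cases hl : IsGenuine l
  · exact integral_pathExitTimeReal_sub_sq_wienerLawC hl.1 hl.2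
  · have hae : (fun p ↦ pathExitTimeReal l.1 l.2 p - pathExitValue l.1 l.2 p ^ 2) =ᵐ[wienerLawC]
        fun _ ↦ 0 := by
      filter_upwards [ae_apply_zero_eq_zero_wienerLawC] with p hp
      rw [pathExitValue_eq_of_not_isGenuine hl hp, pathExitTimeReal_eq_of_not_isGenuine hl hp]
      norm_num
    rw [integral_congr_ae hae, integral_zero]

/-- At every level, `T - V²` is Wiener integrable. [folklore] -/
theorem integrable_pathExitTimeReal_sub_sq_level (l : ℝ × ℝ) :
    Integrable (fun p ↦ pathExitTimeReal l.1 l.2 p - pathExitValue l.1 l.2 p ^ 2) wienerLawC := by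
  by_cases hl : IsGenuine l
  · exact (integrable_pathExitTimeReal_wienerLawC hl.1 hl.2).sub
      (integrable_pathExitValue_sq_wienerLawC hl.1 hl.2)
  · have hae : (fun p ↦ pathExitTimeReal l.1 l.2 p - pathExitValue l.1 l.2 p ^ 2) =ᵐ[wienerLawC]
        fun _ ↦ 0 := by
      filter_upwards [ae_apply_zero_eq_zero_wienerLawC] with p hp
      rw [pathExitValue_eq_of_not_isGenuine hl hp, pathExitTimeReal_eq_of_not_isGenuine hl hp]
      norm_num
    exact (integrable_zero _ _ _).congr hae.symm

/-- At every level with `ℓ₂ - ℓ₁ ≤ R`, `E_W[T²] ≤ C₄ R⁴`, `C₄ = 2/(1-θ₀)²`.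
[cite: LawlerSchrammWerner2004, Lemma 3.8] -/
theorem integral_pathExitTimeReal_sq_level_le (l : ℝ × ℝ) {R : ℝ} (hR : l.2 - l.1 ≤ R) :
    ∫ p, pathExitTimeReal l.1 l.2 p ^ 2 ∂wienerLawC ≤
      2 / (1 - (gaussianReal 0 1).real (Ioo (-1) 1)) ^ 2 * R ^ 4 := by
  have hθ : 0 ≤ 2 / (1 - (gaussianReal 0 1).real (Ioo (-1) 1)) ^ 2 := by positivity
  by_cases hl : IsGenuine l
  · refine (integral_pathExitTimeReal_sq_wienerLawC_le hl.1 hl.2).trans ?_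
    have h0 : 0 ≤ l.2 - l.1 := by linarith [hl.1, hl.2]
    exact mul_le_mul_of_nonneg_left (pow_le_pow_left₀ h0 hR 4) hθ
  · have hae : (fun p ↦ pathExitTimeReal l.1 l.2 p ^ 2) =ᵐ[wienerLawC] fun _ ↦ 0 := by
      filter_upwards [ae_apply_zero_eq_zero_wienerLawC] with p hp
      rw [pathExitTimeReal_eq_of_not_isGenuine hl hp]
      norm_num
    rw [integral_congr_ae hae, integral_zero]
    have : 0 ≤ R ^ 4 := by positivity
    exact mul_nonneg hθ this

/-- At every level, `T²` is Wiener integrable. [folklore] -/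
theorem integrable_pathExitTimeReal_sq_level (l : ℝ × ℝ) :
    Integrable (fun p ↦ pathExitTimeReal l.1 l.2 p ^ 2) wienerLawC := by
  by_cases hl : IsGenuine l
  · exact integrable_pathExitTimeReal_sq_wienerLawC hl.1 hl.2
  · have hae : (fun p ↦ pathExitTimeReal l.1 l.2 p ^ 2) =ᵐ[wienerLawC] fun _ ↦ 0 := by
      filter_upwards [ae_apply_zero_eq_zero_wienerLawC] with p hp
      rw [pathExitTimeReal_eq_of_not_isGenuine hl hp]
      norm_num
    exact (integrable_zero _ _ _).congr hae.symm

/-- **Step integral of a function of the exit value**: `E[g(K) f(V)] = E[g(K) · twoPointAvg ℓ(K) f]`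
for a bounded measurable weight `g` and a measurable `f` bounded on... (no growth condition: the
exit value is a.s. one of finitely many levels; we assume `f` measurable). Durrett (2019),
proofs of Thms. 8.1.1 and 8.2.1. [cite: Durrett2019, Thm. 8.2.1] -/
theorem integral_mul_comp_stepValue (hK : Measurable K) (hZ : Measurable Z) (hℓ : Measurable ℓ)
    (hfin : (Set.range ℓ).Finite) (hZK : IndepFun Z K Q) (hlaw : Q.map Z = wienerLawC)
    {g : 𝒦 → ℝ} (hg : Measurable g) {C : ℝ} (hgb : ∀ k, |g k| ≤ C) {f : ℝ → ℝ} (hf : Measurable f)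
    (hfi : ∀ l : ℝ × ℝ, Integrable (fun p ↦ f (pathExitValue l.1 l.2 p)) wienerLawC) :
    ∫ ω, g (K ω) * f (stepValue K Z ℓ ω) ∂Q = ∫ ω, g (K ω) * twoPointAvg (ℓ (K ω)) f ∂Q := by
  have h := integral_mul_levelwise hK hZ hℓ hfin hZK hlaw hg hgb
    (Ψ := fun l p ↦ f (pathExitValue l.1 l.2 p)) (fun _ ↦ hf.comp (measurable_pathExitValue _ _)) hfi
  simp only [integral_comp_pathExitValue_level] at h
  rw [← sum_integral_indicator_mul (Q := Q) hK hℓ hfin hg hgb (fun l ↦ twoPointAvg l f)]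
  exact h

omit [IsProbabilityMeasure Q] in
/-- **Step integral of the compensator**: `E[g(K) (T - V²)] = 0` for a bounded measurable weight
`g` — the identity `E[τ_{n+1} - τ_n | past] = E[(B_{τ_{n+1}} - B_{τ_n})² | past]` of
Lawler–Schramm–Werner (2004), Lemma 3.8, in test-function form.
[cite: LawlerSchrammWerner2004, Lemma 3.8] -/
theorem integral_mul_stepTime_sub_sq (hK : Measurable K) (hZ : Measurable Z) (hℓ : Measurable ℓ)
    (hfin : (Set.range ℓ).Finite) (hZK : IndepFun Z K Q) (hlaw : Q.map Z = wienerLawC)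
    {g : 𝒦 → ℝ} (hg : Measurable g) {C : ℝ} (hgb : ∀ k, |g k| ≤ C) :
    ∫ ω, g (K ω) * (stepTime K Z ℓ ω - stepValue K Z ℓ ω ^ 2) ∂Q = 0 := by
  have h := integral_mul_levelwise hK hZ hℓ hfin hZK hlaw hg hgb
    (Ψ := fun l p ↦ pathExitTimeReal l.1 l.2 p - pathExitValue l.1 l.2 p ^ 2)
    (fun _ ↦ (measurable_pathExitTimeReal _ _).sub ((measurable_pathExitValue _ _).pow_const 2))
    integrable_pathExitTimeReal_sub_sq_level
  simp only [integral_pathExitTimeReal_sub_sq_level, mul_zero, Finset.sum_const_zero] at h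
  exact h

/-- **Step integral of the squared exit time**: `E[g(K) T²] ≤ C₄ R⁴ E[g(K)]` for a bounded
measurable weight `g ≥ 0`, when all levels have width `≤ R` — the bound
`E[(τ_{n+1} - τ_n)² | past] = O(δ⁴)` of Lawler–Schramm–Werner (2004), proof of Thm. 3.7.
[cite: LawlerSchrammWerner2004, Lemma 3.8] -/
theorem integral_mul_stepTime_sq_le (hK : Measurable K) (hZ : Measurable Z) (hℓ : Measurable ℓ)
    (hfin : (Set.range ℓ).Finite) (hZK : IndepFun Z K Q) (hlaw : Q.map Z = wienerLawC)
    {g : 𝒦 → ℝ} (hg : Measurable g) {C : ℝ} (hgb : ∀ k, |g k| ≤ C) (hg0 : ∀ k, 0 ≤ g k)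
    {R : ℝ} (hR : ∀ k, (ℓ k).2 - (ℓ k).1 ≤ R) :
    ∫ ω, g (K ω) * stepTime K Z ℓ ω ^ 2 ∂Q ≤
      2 / (1 - (gaussianReal 0 1).real (Ioo (-1) 1)) ^ 2 * R ^ 4 * ∫ ω, g (K ω) ∂Q := by
  have h := integral_mul_levelwise hK hZ hℓ hfin hZK hlaw hg hgb
    (Ψ := fun l p ↦ pathExitTimeReal l.1 l.2 p ^ 2)
    (fun _ ↦ (measurable_pathExitTimeReal _ _).pow_const 2) integrable_pathExitTimeReal_sq_level
  change ∫ ω, g (K ω) * pathExitTimeReal (ℓ (K ω)).1 (ℓ (K ω)).2 (Z ω) ^ 2 ∂Q ≤ _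
  rw [h]
  have hrec := sum_integral_indicator_mul (Q := Q) hK hℓ hfin hg hgb (fun _ ↦ (1 : ℝ))
  simp only [mul_one] at hrec
  rw [← hrec, Finset.mul_sum]
  refine Finset.sum_le_sum fun l hl ↦ ?_
  have hI : 0 ≤ ∫ ω, ((fun ω ↦ ℓ (K ω)) ⁻¹' {l}).indicator (fun ω ↦ g (K ω)) ω ∂Q :=
    integral_nonneg fun ω ↦ Set.indicator_nonneg (fun _ _ ↦ hg0 _) _
  have hlR : l.2 - l.1 ≤ R := by
    obtain ⟨ω, rfl⟩ : l ∈ Set.range fun ω ↦ ℓ (K ω) := by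
      simpa using (finite_range_level (K := K) hfin).mem_toFinset.1 hl
    exact hR _
  calc (∫ ω, ((fun ω ↦ ℓ (K ω)) ⁻¹' {l}).indicator (fun ω ↦ g (K ω)) ω ∂Q) *
        ∫ p, pathExitTimeReal l.1 l.2 p ^ 2 ∂wienerLawC
      ≤ (∫ ω, ((fun ω ↦ ℓ (K ω)) ⁻¹' {l}).indicator (fun ω ↦ g (K ω)) ω ∂Q) *
          (2 / (1 - (gaussianReal 0 1).real (Ioo (-1) 1)) ^ 2 * R ^ 4) :=
        mul_le_mul_of_nonneg_left (integral_pathExitTimeReal_sq_level_le l hlR) hI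
    _ = 2 / (1 - (gaussianReal 0 1).real (Ioo (-1) 1)) ^ 2 * R ^ 4 *
          ∫ ω, ((fun ω ↦ ℓ (K ω)) ⁻¹' {l}).indicator (fun ω ↦ g (K ω)) ω ∂Q := by ring


/-! ### Freezing the known data -/

omit [MeasurableSpace C(ℝ≥0, ℝ)] [BorelSpace C(ℝ≥0, ℝ)] in
/-- **Freezing lemma**: for `K ⊥ Y` and a bounded jointly measurable `F`,
`E[F(K, Y)] = E_ω[∫ F(K(ω), z) dLaw(Y)(z)]`. (The same Fubini argument as the freezing formula of
`BrownianStrongMarkov`.) [folklore] -/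
theorem integral_indepFun_eq_integral_integral {𝒵 : Type*} [MeasurableSpace 𝒵] {Y : Ω₁ → 𝒵}
    (hK : Measurable K) (hY : Measurable Y) (hKY : IndepFun K Y Q) {F : 𝒦 → 𝒵 → ℝ}
    (hF : Measurable (Function.uncurry F)) {C : ℝ} (hFb : ∀ k z, |F k z| ≤ C) :
    ∫ ω, F (K ω) (Y ω) ∂Q = ∫ ω, (∫ z, F (K ω) z ∂(Q.map Y)) ∂Q := by
  have hFint : ∀ (μ : Measure (𝒦 × 𝒵)) [IsFiniteMeasure μ], Integrable (Function.uncurry F) μ :=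
    fun μ _ ↦ (integrable_const C).mono' hF.aestronglyMeasurable (Eventually.of_forall fun p ↦ by
      rw [Real.norm_eq_abs]; exact hFb p.1 p.2)
  have hpair : Q.map (fun ω ↦ (K ω, Y ω)) = (Q.map K).prod (Q.map Y) :=
    (indepFun_iff_map_prod_eq_prod_map_map hK.aemeasurable hY.aemeasurable).1 hKY
  haveI : IsProbabilityMeasure (Q.map K) := Measure.isProbabilityMeasure_map hK.aemeasurable
  haveI : IsProbabilityMeasure (Q.map Y) := Measure.isProbabilityMeasure_map hY.aemeasurable
  have h1 : ∫ ω, F (K ω) (Y ω) ∂Q = ∫ p, Function.uncurry F p ∂(Q.map fun ω ↦ (K ω, Y ω)) := by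
    rw [integral_map (hK.prodMk hY).aemeasurable hF.aestronglyMeasurable]
    rfl
  rw [h1, hpair, integral_prod _ (hFint _), integral_map hK.aemeasurable]
  · rfl
  · exact (hF.stronglyMeasurable.integral_prod_right').aestronglyMeasurable

omit [MeasurableSpace C(ℝ≥0, ℝ)] [BorelSpace C(ℝ≥0, ℝ)] in
/-- The two-point average of a function bounded by `C` is bounded by `C` (a convex combination
of two values, or one value). [folklore] -/
theorem abs_twoPointAvg_le {f : ℝ → ℝ} {C : ℝ} (hfb : ∀ v, |f v| ≤ C) (l : ℝ × ℝ) :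
    |twoPointAvg l f| ≤ C := by
  unfold twoPointAvg
  split_ifs with h
  · have hd : 0 < l.2 - l.1 := by linarith [h.1, h.2]
    rw [abs_div, abs_of_pos hd, div_le_iff₀ hd]
    have h1 := hfb l.1
    have h2 := hfb l.2
    calc |l.2 * f l.1 - l.1 * f l.2| ≤ |l.2 * f l.1| + |l.1 * f l.2| := abs_sub _ _
      _ = l.2 * |f l.1| + (-l.1) * |f l.2| := by
          rw [abs_mul, abs_mul, abs_of_pos h.2, abs_of_neg h.1]
      _ ≤ l.2 * C + (-l.1) * C := by
          gcongr
          · exact h.2.le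
          · linarith [h.1]
      _ = C * (l.2 - l.1) := by ring
  · exact hfb 0

/-- **Step integral of a function of the known data and the exit value**:
`E[g(K) f(K, V)] = E[g(K) · twoPointAvg ℓ(K) (f K)]` for bounded measurable `g` and bounded
jointly measurable `f` (freeze `K` on each level fibre, then gambler's ruin). Durrett (2019),
proofs of Thms. 8.1.1, 8.2.1 (the law of the next value given the past and the randomiser).
[cite: Durrett2019, Thm. 8.2.1] -/
theorem integral_mul_stepValue_dep (hK : Measurable K) (hZ : Measurable Z) (hℓ : Measurable ℓ)
    (hfin : (Set.range ℓ).Finite) (hZK : IndepFun Z K Q) (hlaw : Q.map Z = wienerLawC)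
    {g : 𝒦 → ℝ} (hg : Measurable g) {C : ℝ} (hgb : ∀ k, |g k| ≤ C)
    {f : 𝒦 → ℝ → ℝ} (hf : Measurable (Function.uncurry f)) {Cf : ℝ} (hfb : ∀ k v, |f k v| ≤ Cf) :
    ∫ ω, g (K ω) * f (K ω) (stepValue K Z ℓ ω) ∂Q =
      ∫ ω, g (K ω) * twoPointAvg (ℓ (K ω)) (f (K ω)) ∂Q := by
  set lev : Ω₁ → ℝ × ℝ := fun ω ↦ ℓ (K ω) with hlev
  have hfin' : (Set.range lev).Finite := finite_range_level hfin
  have hfib : ∀ l, MeasurableSet (lev ⁻¹' {l}) := measurableSet_level_fibre hK hℓ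
  -- both integrands are bounded and measurable
  have hmV : Measurable (stepValue K Z ℓ) := measurable_stepValue hK hZ hℓ hfin
  have hmL : Measurable fun ω ↦ g (K ω) * f (K ω) (stepValue K Z ℓ ω) :=
    (hg.comp hK).mul (hf.comp (hK.prodMk hmV))
  have hbL : ∀ ω, |g (K ω) * f (K ω) (stepValue K Z ℓ ω)| ≤ |C| * |Cf| := fun ω ↦ by
    rw [abs_mul]
    exact mul_le_mul ((hgb _).trans (le_abs_self C)) ((hfb _ _).trans (le_abs_self Cf))
      (abs_nonneg _) (abs_nonneg _)
  have hiL : Integrable (fun ω ↦ g (K ω) * f (K ω) (stepValue K Z ℓ ω)) Q :=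
    (integrable_const (|C| * |Cf|)).mono' hmL.aestronglyMeasurable
      (ae_of_all _ fun ω ↦ by rw [Real.norm_eq_abs]; exact hbL ω)
  have hmT : Measurable fun ω ↦ twoPointAvg (lev ω) (f (K ω)) := by
    refine measurable_levelwise (lev := lev) hfin' hfib (f := fun l ω ↦ twoPointAvg l (f (K ω)))
      fun l ↦ ?_
    unfold twoPointAvg
    split_ifs
    · exact ((measurable_const.mul (hf.comp (hK.prodMk measurable_const))).sub
        (measurable_const.mul (hf.comp (hK.prodMk measurable_const)))).div_const _
    · exact hf.comp (hK.prodMk measurable_const)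
  have hmR : Measurable fun ω ↦ g (K ω) * twoPointAvg (lev ω) (f (K ω)) := (hg.comp hK).mul hmT
  have hbR : ∀ ω, |g (K ω) * twoPointAvg (lev ω) (f (K ω))| ≤ |C| * |Cf| := fun ω ↦ by
    rw [abs_mul]
    exact mul_le_mul ((hgb _).trans (le_abs_self C))
      ((abs_twoPointAvg_le (hfb (K ω)) _).trans (le_abs_self Cf)) (abs_nonneg _) (abs_nonneg _)
  have hiR : Integrable (fun ω ↦ g (K ω) * twoPointAvg (lev ω) (f (K ω))) Q :=
    (integrable_const (|C| * |Cf|)).mono' hmR.aestronglyMeasurable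
      (ae_of_all _ fun ω ↦ by rw [Real.norm_eq_abs]; exact hbR ω)
  rw [integral_eq_sum_levels hfin' hfib hiL, integral_eq_sum_levels hfin' hfib hiR]
  refine Finset.sum_congr rfl fun l _ ↦ ?_
  -- on the fibre `{lev = l}`: freeze `K`
  set F : 𝒦 → C(ℝ≥0, ℝ) → ℝ := fun k z ↦ (ℓ ⁻¹' {l}).indicator g k * f k (pathExitValue l.1 l.2 z)
    with hFdef
  have hFm : Measurable (Function.uncurry F) :=
    ((hg.indicator (hℓ (measurableSet_singleton l))).comp measurable_fst).mul
      (hf.comp (measurable_fst.prodMk ((measurable_pathExitValue _ _).comp measurable_snd)))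
  have hFb : ∀ k z, |F k z| ≤ |C| * |Cf| := fun k z ↦ by
    rw [hFdef, abs_mul]
    refine mul_le_mul ?_ ((hfb _ _).trans (le_abs_self Cf)) (abs_nonneg _) (abs_nonneg _)
    by_cases hk : k ∈ ℓ ⁻¹' {l}
    · rw [indicator_of_mem hk]; exact (hgb _).trans (le_abs_self C)
    · rw [indicator_of_notMem hk, abs_zero]; exact abs_nonneg _
  have hind : ∀ ω, (lev ⁻¹' {l}).indicator (fun ω ↦ g (K ω) * f (K ω) (stepValue K Z ℓ ω)) ω =
      F (K ω) (Z ω) := by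
    intro ω
    rw [hFdef]
    by_cases hω : ω ∈ lev ⁻¹' {l}
    · have hω' : K ω ∈ ℓ ⁻¹' {l} := hω
      simp only [indicator_of_mem hω, indicator_of_mem hω', stepValue]
      rw [show ℓ (K ω) = l from hω]
    · have hω' : K ω ∉ ℓ ⁻¹' {l} := hω
      simp only [indicator_of_notMem hω, indicator_of_notMem hω', zero_mul]
  have hind' : ∀ ω, (lev ⁻¹' {l}).indicator (fun ω ↦ g (K ω) * twoPointAvg (lev ω) (f (K ω))) ω =
      ∫ z, F (K ω) z ∂wienerLawC := by
    intro ω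
    rw [hFdef]
    simp only []
    rw [integral_const_mul, integral_comp_pathExitValue_level l (f (K ω))]
    by_cases hω : ω ∈ lev ⁻¹' {l}
    · have hω' : K ω ∈ ℓ ⁻¹' {l} := hω
      rw [indicator_of_mem hω, indicator_of_mem hω', show lev ω = l from hω]
    · have hω' : K ω ∉ ℓ ⁻¹' {l} := hω
      rw [indicator_of_notMem hω, indicator_of_notMem hω', zero_mul]
  rw [integral_congr_ae (ae_of_all _ hind), integral_congr_ae (ae_of_all _ hind'),
    integral_indepFun_eq_integral_integral hK hZ hZK.symm hFm hFb, hlaw]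


/-! ### Integrability of the step quantities -/

omit [BorelSpace C(ℝ≥0, ℝ)] [IsProbabilityMeasure Q] in
/-- A levelwise-defined real functional of `Z` is integrable as soon as each level is Wiener
integrable (finitely many levels; dominate by the sum). [folklore] -/
theorem integrable_levelwise_comp (hK : Measurable K) (hZ : Measurable Z) (hℓ : Measurable ℓ)
    (hfin : (Set.range ℓ).Finite) (hlaw : Q.map Z = wienerLawC)
    {Ψ : ℝ × ℝ → C(ℝ≥0, ℝ) → ℝ} (hΨm : ∀ l, Measurable (Ψ l))
    (hΨi : ∀ l, Integrable (Ψ l) wienerLawC) :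
    Integrable (fun ω ↦ Ψ (ℓ (K ω)) (Z ω)) Q := by
  set lev : Ω₁ → ℝ × ℝ := fun ω ↦ ℓ (K ω) with hlev
  have hfin' : (Set.range lev).Finite := finite_range_level hfin
  have hfib : ∀ l, MeasurableSet (lev ⁻¹' {l}) := measurableSet_level_fibre hK hℓ
  have hΨZ : ∀ l, Integrable (fun ω ↦ Ψ l (Z ω)) Q := fun l ↦
    (integrable_map_measure (hΨm l).aestronglyMeasurable hZ.aemeasurable).1 (hlaw ▸ hΨi l)
  have hm : Measurable fun ω ↦ Ψ (lev ω) (Z ω) :=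
    measurable_levelwise (lev := lev) hfin' hfib (f := fun l ω ↦ Ψ l (Z ω)) fun l ↦ (hΨm l).comp hZ
  have hdom : Integrable (fun ω ↦ ∑ l ∈ hfin'.toFinset, |Ψ l (Z ω)|) Q :=
    integrable_finsetSum _ fun l _ ↦ (hΨZ l).abs
  refine hdom.mono' hm.aestronglyMeasurable (ae_of_all _ fun ω ↦ ?_)
  rw [Real.norm_eq_abs]
  exact Finset.single_le_sum (f := fun l ↦ |Ψ l (Z ω)|) (fun l _ ↦ abs_nonneg _)
    (by simp [hlev] : lev ω ∈ hfin'.toFinset)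

/-- At every level, the real exit time is Wiener integrable. [folklore] -/
theorem integrable_pathExitTimeReal_level (l : ℝ × ℝ) :
    Integrable (pathExitTimeReal l.1 l.2) wienerLawC := by
  by_cases hl : IsGenuine l
  · exact integrable_pathExitTimeReal_wienerLawC hl.1 hl.2
  · have hae : (pathExitTimeReal l.1 l.2) =ᵐ[wienerLawC] fun _ ↦ 0 := by
      filter_upwards [ae_apply_zero_eq_zero_wienerLawC] with p hp
      rw [pathExitTimeReal_eq_of_not_isGenuine hl hp]
    exact (integrable_zero _ _ _).congr hae.symm

/-- At every level, the squared exit value is Wiener integrable (it is a.s. bounded). [folklore] -/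
theorem integrable_pathExitValue_sq_level (l : ℝ × ℝ) :
    Integrable (fun p ↦ pathExitValue l.1 l.2 p ^ 2) wienerLawC := by
  by_cases hl : IsGenuine l
  · exact integrable_pathExitValue_sq_wienerLawC hl.1 hl.2
  · have hae : (fun p ↦ pathExitValue l.1 l.2 p ^ 2) =ᵐ[wienerLawC] fun _ ↦ 0 := by
      filter_upwards [ae_apply_zero_eq_zero_wienerLawC] with p hp
      rw [pathExitValue_eq_of_not_isGenuine hl hp]
      norm_num
    exact (integrable_zero _ _ _).congr hae.symm

omit [IsProbabilityMeasure Q] in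
/-- **The exit time of the step is integrable.** [folklore] -/
theorem integrable_stepTime (hK : Measurable K) (hZ : Measurable Z) (hℓ : Measurable ℓ)
    (hfin : (Set.range ℓ).Finite) (hlaw : Q.map Z = wienerLawC) : Integrable (stepTime K Z ℓ) Q :=
  integrable_levelwise_comp hK hZ hℓ hfin hlaw (Ψ := fun l p ↦ pathExitTimeReal l.1 l.2 p)
    (fun _ ↦ measurable_pathExitTimeReal _ _) integrable_pathExitTimeReal_level

omit [IsProbabilityMeasure Q] in
/-- **The squared exit time of the step is integrable.** [folklore] -/
theorem integrable_stepTime_sq (hK : Measurable K) (hZ : Measurable Z) (hℓ : Measurable ℓ)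
    (hfin : (Set.range ℓ).Finite) (hlaw : Q.map Z = wienerLawC) :
    Integrable (fun ω ↦ stepTime K Z ℓ ω ^ 2) Q :=
  integrable_levelwise_comp hK hZ hℓ hfin hlaw (Ψ := fun l p ↦ pathExitTimeReal l.1 l.2 p ^ 2)
    (fun _ ↦ (measurable_pathExitTimeReal _ _).pow_const 2) integrable_pathExitTimeReal_sq_level

omit [IsProbabilityMeasure Q] in
/-- **The squared exit value of the step is integrable.** [folklore] -/
theorem integrable_stepValue_sq (hK : Measurable K) (hZ : Measurable Z) (hℓ : Measurable ℓ)
    (hfin : (Set.range ℓ).Finite) (hlaw : Q.map Z = wienerLawC) :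
    Integrable (fun ω ↦ stepValue K Z ℓ ω ^ 2) Q :=
  integrable_levelwise_comp hK hZ hℓ hfin hlaw (Ψ := fun l p ↦ pathExitValue l.1 l.2 p ^ 2)
    (fun _ ↦ (measurable_pathExitValue _ _).pow_const 2) integrable_pathExitValue_sq_level

end Step

end Literature.Probability.RandomPlanarGeometry.SkorokhodEmbedding
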